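import Mathlib
import HarnessLib
import Summits.AtomisticToContinuum.Crystallization.Theorems.PricedLinkCensusSoftFourRingsCapBlock

/-!
# Soft four-rings: preparations for the exclusion of slack triangles

Support file for `SoftFourRings` (route `PricedLinkCensus`, sub-problem `Crystallization`),
conditional on Tammes-13.

* `slack_labels` : a slack triangle `{a, b, c}` can be labelled with `ab` its bond side;
* `slack_block_data` : the block of a slack triangle in the packaged (bond-set level) form;
* `slack_partition` : the vertices with three bond triangles are the disjoint union of the slack
  triangles, so their number is three times the number of slack triangles.

**`Cap` variant** (seat c3 of stmt-AtomisticToContinuum-14234): identical to `PricedLinkCensusSoftFourRingsNoSlackPrep`, except that the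
global Tammes-13 hypothesis `(hT : musinTarasov2012_tammes_thirteen)` is replaced by the LOCAL covering
property of the twelve directions, `hT : ∀ p, ‖p‖ = 1 → ∃ x ∈ X, dist p x < 0.957` (no empty cap of
angular radius `57.18°`), which is all the two roots (`FacetCap`, `Interior`) ever used; the hT-free
lemmas are not repeated (the original file is imported for them).
-/

namespace Summit.AtomisticToContinuum.Crystallization.Theorems.Cap

open Real RealInnerProductSpace Literature.Geometry.DiscreteGeometry

section Setting

open scoped Classical in
/-- **Labelling a slack triangle**: its unique bond side is `ab`, the other two sides `ca`, `cb`
are not bonds. -/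
theorem slack_labels
    {X : Finset (EuclideanSpace ℝ (Fin 3))}
    {B : Finset (Finset (EuclideanSpace ℝ (Fin 3)))}
    (hT : ∀ p : EuclideanSpace ℝ (Fin 3), ‖p‖ = 1 → ∃ x ∈ X, dist p x < 0.957)
    (hX1 : ∀ y ∈ X, ‖y‖ = 1)
    (hcard : X.card = 12)
    (hsepX : ∀ u ∈ X, ∀ u' ∈ X, u ≠ u' → ⟪u, u'⟫ ≤ 1 - 1 / (2 * (101 / 100 : ℝ) ^ 2))
    (hB : ∀ T ∈ B, ∃ u ∈ X, ∃ u' ∈ X, u ≠ u' ∧ 1 - (101 / 100 : ℝ) ^ 2 / 2 ≤ ⟪u, u'⟫ ∧ T = {u, u'})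
    (hBcard : B.card = 24) {cf : EuclideanSpace ℝ (Fin 3)} (hcfF : cf ∈ facetNormals X)
    (hcf3 : (tightSet X cf).card = 3) (hcfnb : ((edgesOfFacet X cf).filter (fun T => T ∉ B)).card = 2) :
    ∃ a b c : EuclideanSpace ℝ (Fin 3), tightSet X cf = {a, b, c} ∧
      ({a, b} : Finset (EuclideanSpace ℝ (Fin 3))) ∈ B ∧
      ({c, a} : Finset (EuclideanSpace ℝ (Fin 3))) ∉ B ∧
      ({c, b} : Finset (EuclideanSpace ℝ (Fin 3))) ∉ B := by
  have h0 : (0 : EuclideanSpace ℝ (Fin 3)) ∈ interior (convexHull ℝ (X : Set (EuclideanSpace ℝ (Fin 3)))) :=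
    zero_mem_interior_convexHull_of_twelve_le_card hT hX1 hcard.ge
      (ca := 1 - 1 / (2 * (101 / 100 : ℝ) ^ 2)) (by norm_num) hsepX
  obtain ⟨-, hBH, -⟩ := hull_counts_of_twelve hT hX1 hcard hsepX hB hBcard
  -- exactly one side is a bond
  have hE3 : (edgesOfFacet X cf).card = 3 := (card_edgesOfFacet hX1 h0 hcfF).trans hcf3
  have hb1 : ((edgesOfFacet X cf).filter (fun T => T ∈ B)).card = 1 := by
    have := Finset.card_filter_add_card_filter_not (s := edgesOfFacet X cf) (fun T => T ∈ B)
    rw [hE3, hcfnb] at this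
    omega
  obtain ⟨Tb, hTb⟩ := Finset.card_eq_one.1 hb1
  have hTbm : Tb ∈ (edgesOfFacet X cf).filter (fun T => T ∈ B) := by rw [hTb]; simp
  obtain ⟨hTbE, hTbB⟩ := Finset.mem_filter.1 hTbm
  obtain ⟨a, -, b, -, hab, -, rfl⟩ := hB _ hTbB
  have hsub : ({a, b} : Finset (EuclideanSpace ℝ (Fin 3))) ⊆ tightSet X cf := by
    unfold edgesOfFacet at hTbE
    exact (Finset.mem_filter.1 hTbE).2
  have ha : a ∈ tightSet X cf := hsub (by simp)
  have hb : b ∈ tightSet X cf := hsub (by simp)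
  -- the third vertex
  have hc1 : (tightSet X cf \ {a, b}).card = 1 := by
    rw [Finset.card_sdiff_of_subset hsub, hcf3, Finset.card_pair hab]
  obtain ⟨c, hc⟩ := Finset.card_eq_one.1 hc1
  have hcm : c ∈ tightSet X cf \ {a, b} := by rw [hc]; simp
  rw [Finset.mem_sdiff, Finset.mem_insert, Finset.mem_singleton, not_or] at hcm
  obtain ⟨hcT, hca, hcb⟩ := hcm
  have hTabc : tightSet X cf = {a, b, c} := by
    rw [← Finset.union_sdiff_of_subset hsub, hc]
    ext x; simp
  -- the other two sides are not bonds
  have hside : ∀ x, x ∈ tightSet X cf → x ≠ a → x ≠ b →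
      ({x, a} : Finset (EuclideanSpace ℝ (Fin 3))) ∉ B ∧
      ({x, b} : Finset (EuclideanSpace ℝ (Fin 3))) ∉ B := by
    intro x hx hxa hxb
    constructor
    · intro h
      have hm : ({x, a} : Finset (EuclideanSpace ℝ (Fin 3))) ∈
          (edgesOfFacet X cf).filter (fun T => T ∈ B) :=
        Finset.mem_filter.2 ⟨pair_mem_edgesOfFacet_of_card_three hX1 h0 hcfF hcf3 hx ha hxa, h⟩
      rw [hTb, Finset.mem_singleton] at hm
      have : x ∈ ({a, b} : Finset (EuclideanSpace ℝ (Fin 3))) := by rw [← hm]; simp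
      rw [Finset.mem_insert, Finset.mem_singleton] at this
      rcases this with h' | h'
      exacts [hxa h', hxb h']
    · intro h
      have hm : ({x, b} : Finset (EuclideanSpace ℝ (Fin 3))) ∈
          (edgesOfFacet X cf).filter (fun T => T ∈ B) :=
        Finset.mem_filter.2 ⟨pair_mem_edgesOfFacet_of_card_three hX1 h0 hcfF hcf3 hx hb hxb, h⟩
      rw [hTb, Finset.mem_singleton] at hm
      have : x ∈ ({a, b} : Finset (EuclideanSpace ℝ (Fin 3))) := by rw [← hm]; simp
      rw [Finset.mem_insert, Finset.mem_singleton] at this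
      rcases this with h' | h'
      exacts [hxa h', hxb h']
  have _ := hBH
  exact ⟨a, b, c, hTabc, hTbB, hside c hcT hca hcb⟩

open scoped Classical in
/-- **Block data of a slack triangle**, packaged at the bond-set level. -/
theorem slack_block_data
    {X : Finset (EuclideanSpace ℝ (Fin 3))}
    {B : Finset (Finset (EuclideanSpace ℝ (Fin 3)))}
    (hT : ∀ p : EuclideanSpace ℝ (Fin 3), ‖p‖ = 1 → ∃ x ∈ X, dist p x < 0.957)
    (hX1 : ∀ y ∈ X, ‖y‖ = 1)
    (hcard : X.card = 12)
    (hsepX : ∀ u ∈ X, ∀ u' ∈ X, u ≠ u' → ⟪u, u'⟫ ≤ 1 - 1 / (2 * (101 / 100 : ℝ) ^ 2))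
    (hB : ∀ T ∈ B, ∃ u ∈ X, ∃ u' ∈ X, u ≠ u' ∧ 1 - (101 / 100 : ℝ) ^ 2 / 2 ≤ ⟪u, u'⟫ ∧ T = {u, u'})
    (hBcard : B.card = 24)
    (hdeg : ∀ v ∈ X, ∃ w : Fin 4 → EuclideanSpace ℝ (Fin 3), (∀ k, w k ∈ X) ∧ Function.Injective w ∧ (∀ k, w k ≠ v) ∧ (∀ k, ({v, w k} : Finset (EuclideanSpace ℝ (Fin 3))) ∈ B) ∧ ∀ y, ({v, y} : Finset (EuclideanSpace ℝ (Fin 3))) ∈ B → ∃ k, y = w k) {cf : EuclideanSpace ℝ (Fin 3)} (hcfF : cf ∈ facetNormals X)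
    (hcf3 : (tightSet X cf).card = 3) (hcfnb : ((edgesOfFacet X cf).filter (fun T => T ∉ B)).card = 2) :
    ∃ a b c p q u w m n r : EuclideanSpace ℝ (Fin 3), tightSet X cf = {a, b, c} ∧
      (a ∈ X ∧ b ∈ X ∧ c ∈ X ∧ a ≠ c ∧ b ≠ c) ∧
      ((p ∈ X ∧ q ∈ X ∧ u ∈ X ∧ w ∈ X ∧ m ∈ X ∧ n ∈ X ∧ r ∈ X) ∧
      (∀ y, ({a, y} : Finset (EuclideanSpace ℝ (Fin 3))) ∈ B ↔ (y = p ∨ y = u ∨ y = r ∨ y = b)) ∧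
      (∀ y, ({b, y} : Finset (EuclideanSpace ℝ (Fin 3))) ∈ B ↔ (y = q ∨ y = w ∨ y = r ∨ y = a)) ∧
      (∀ y, ({c, y} : Finset (EuclideanSpace ℝ (Fin 3))) ∈ B ↔ (y = p ∨ y = n ∨ y = m ∨ y = q)) ∧
      (∀ y, ({r, y} : Finset (EuclideanSpace ℝ (Fin 3))) ∈ B ↔ (y = u ∨ y = a ∨ y = b ∨ y = w)) ∧
      (({p, u} : Finset (EuclideanSpace ℝ (Fin 3))) ∈ B ∧
        ({u, r} : Finset (EuclideanSpace ℝ (Fin 3))) ∈ B ∧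
        ({r, b} : Finset (EuclideanSpace ℝ (Fin 3))) ∈ B ∧
        ({q, w} : Finset (EuclideanSpace ℝ (Fin 3))) ∈ B ∧
        ({w, r} : Finset (EuclideanSpace ℝ (Fin 3))) ∈ B ∧
        ({p, n} : Finset (EuclideanSpace ℝ (Fin 3))) ∈ B ∧
        ({n, m} : Finset (EuclideanSpace ℝ (Fin 3))) ∈ B ∧
        ({m, q} : Finset (EuclideanSpace ℝ (Fin 3))) ∈ B) ∧
      (({p, r} : Finset (EuclideanSpace ℝ (Fin 3))) ∉ B ∧
        ({u, b} : Finset (EuclideanSpace ℝ (Fin 3))) ∉ B ∧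
        ({p, b} : Finset (EuclideanSpace ℝ (Fin 3))) ∉ B ∧
        ({q, r} : Finset (EuclideanSpace ℝ (Fin 3))) ∉ B ∧
        ({w, a} : Finset (EuclideanSpace ℝ (Fin 3))) ∉ B ∧
        ({q, a} : Finset (EuclideanSpace ℝ (Fin 3))) ∉ B ∧
        ({p, m} : Finset (EuclideanSpace ℝ (Fin 3))) ∉ B ∧
        ({n, q} : Finset (EuclideanSpace ℝ (Fin 3))) ∉ B ∧
        ({p, q} : Finset (EuclideanSpace ℝ (Fin 3))) ∉ B ∧
        ({u, w} : Finset (EuclideanSpace ℝ (Fin 3))) ∉ B) ∧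
      ((p ≠ u ∧ p ≠ r ∧ p ≠ b ∧ u ≠ r ∧ u ≠ b ∧ r ≠ b) ∧
        (q ≠ w ∧ q ≠ r ∧ q ≠ a ∧ w ≠ r ∧ w ≠ a ∧ r ≠ a) ∧
        (p ≠ n ∧ p ≠ m ∧ p ≠ q ∧ n ≠ m ∧ n ≠ q ∧ m ≠ q) ∧
        (u ≠ a ∧ u ≠ b ∧ u ≠ w ∧ a ≠ b ∧ a ≠ w ∧ b ≠ w) ∧ r ≠ c) ∧
      (∀ y, ({p, y} : Finset (EuclideanSpace ℝ (Fin 3))) ∈ B ↔ (y = a ∨ y = u ∨ y = c ∨ y = n)) ∧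
      (∀ y, ({q, y} : Finset (EuclideanSpace ℝ (Fin 3))) ∈ B ↔ (y = b ∨ y = w ∨ y = c ∨ y = m))) ∧
      (((facetNormals X).filter (fun c => r ∈ tightSet X c ∧ (tightSet X c).card = 3 ∧
        ((edgesOfFacet X c).filter (fun T => T ∉ B)).card = 0)).card = 3 ∧
       ((facetNormals X).filter (fun c => p ∈ tightSet X c ∧ (tightSet X c).card = 3 ∧
        ((edgesOfFacet X c).filter (fun T => T ∉ B)).card = 0)).card = 2 ∧
       ((facetNormals X).filter (fun c => q ∈ tightSet X c ∧ (tightSet X c).card = 3 ∧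
        ((edgesOfFacet X c).filter (fun T => T ∉ B)).card = 0)).card = 2) ∧ r ∉ tightSet X cf := by
  obtain ⟨a, b, c, hTabc, hab, hca, hcb⟩ := slack_labels hT hX1 hcard hsepX hB hBcard hcfF hcf3 hcfnb
  obtain ⟨hab', hac, hbc⟩ := card_three_distinct (hTabc ▸ hcf3)
  have haT : a ∈ tightSet X cf := by rw [hTabc]; simp
  have hbT : b ∈ tightSet X cf := by rw [hTabc]; simp
  have hcT : c ∈ tightSet X cf := by rw [hTabc]; simp
  obtain ⟨p, q, u, w, m, n, r, hX, hNa, hNb, hNc, hNr, hbonds, hchords, hdist, htr, hNp, hNq, htp,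
    htq⟩ := slack_block hT hX1 hcard hsepX hB hBcard hdeg hcfF hcf3 hcfnb hTabc hab hca hcb
  refine ⟨a, b, c, p, q, u, w, m, n, r, hTabc, ⟨(mem_tightSet.1 haT).1, (mem_tightSet.1 hbT).1,
    (mem_tightSet.1 hcT).1, hac, hbc⟩, ⟨hX, hNa, hNb, hNc, hNr, hbonds, hchords, hdist, hNp, hNq⟩,
    ⟨htr, htp, htq⟩, ?_⟩
  rw [hTabc]
  exact not_mem_three hdist.2.1.2.2.2.2.2 hdist.1.2.2.2.2.2 hdist.2.2.2.2

open scoped Classical in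
/-- **The slack partition**: the vertices with three bond triangles are the disjoint union of
the (tight sets of the) slack triangles. -/
theorem slack_partition
    {X : Finset (EuclideanSpace ℝ (Fin 3))}
    {B : Finset (Finset (EuclideanSpace ℝ (Fin 3)))}
    (hT : ∀ p : EuclideanSpace ℝ (Fin 3), ‖p‖ = 1 → ∃ x ∈ X, dist p x < 0.957)
    (hX1 : ∀ y ∈ X, ‖y‖ = 1)
    (hcard : X.card = 12)
    (hsepX : ∀ u ∈ X, ∀ u' ∈ X, u ≠ u' → ⟪u, u'⟫ ≤ 1 - 1 / (2 * (101 / 100 : ℝ) ^ 2))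
    (hB : ∀ T ∈ B, ∃ u ∈ X, ∃ u' ∈ X, u ≠ u' ∧ 1 - (101 / 100 : ℝ) ^ 2 / 2 ≤ ⟪u, u'⟫ ∧ T = {u, u'})
    (hBcard : B.card = 24)
    (hdeg : ∀ v ∈ X, ∃ w : Fin 4 → EuclideanSpace ℝ (Fin 3), (∀ k, w k ∈ X) ∧ Function.Injective w ∧ (∀ k, w k ≠ v) ∧ (∀ k, ({v, w k} : Finset (EuclideanSpace ℝ (Fin 3))) ∈ B) ∧ ∀ y, ({v, y} : Finset (EuclideanSpace ℝ (Fin 3))) ∈ B → ∃ k, y = w k) :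
    (X.filter (fun v => ((facetNormals X).filter (fun c => v ∈ tightSet X c ∧ (tightSet X c).card = 3 ∧
        ((edgesOfFacet X c).filter (fun T => T ∉ B)).card = 0)).card = 3)) =
      ((facetNormals X).filter (fun c => (tightSet X c).card = 3 ∧
      ((edgesOfFacet X c).filter (fun T => T ∉ B)).card = 2)).biUnion (fun c => tightSet X c) ∧
    (∀ c ∈ ((facetNormals X).filter (fun c => (tightSet X c).card = 3 ∧
      ((edgesOfFacet X c).filter (fun T => T ∉ B)).card = 2)),
      ∀ c' ∈ ((facetNormals X).filter (fun c => (tightSet X c).card = 3 ∧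
      ((edgesOfFacet X c).filter (fun T => T ∉ B)).card = 2)),
      c ≠ c' → Disjoint (tightSet X c) (tightSet X c')) ∧
    (X.filter (fun v => ((facetNormals X).filter (fun c => v ∈ tightSet X c ∧ (tightSet X c).card = 3 ∧
        ((edgesOfFacet X c).filter (fun T => T ∉ B)).card = 0)).card = 3)).card =
      3 * ((facetNormals X).filter (fun c => (tightSet X c).card = 3 ∧
      ((edgesOfFacet X c).filter (fun T => T ∉ B)).card = 2)).card := by
  obtain ⟨-, -, -, hC3, hC5⟩ := tight_counts_one_percent hT hX1 hcard hsepX hB hBcard hdeg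
  have hdis : ∀ c ∈ ((facetNormals X).filter (fun c => (tightSet X c).card = 3 ∧
      ((edgesOfFacet X c).filter (fun T => T ∉ B)).card = 2)),
      ∀ c' ∈ ((facetNormals X).filter (fun c => (tightSet X c).card = 3 ∧
      ((edgesOfFacet X c).filter (fun T => T ∉ B)).card = 2)),
      c ≠ c' → Disjoint (tightSet X c) (tightSet X c') := by
    intro c hc c' hc' hne
    obtain ⟨hcF, hc3, hcnb⟩ := Finset.mem_filter.1 hc
    obtain ⟨hc'F, hc'3, hc'nb⟩ := Finset.mem_filter.1 hc'
    rw [Finset.disjoint_left]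
    intro v hv hv'
    obtain ⟨c₀, -, -, -, -, huniq⟩ := hC5 v (mem_tightSet.1 hv).1 (hC3 c hcF hc3 hcnb v hv)
    exact hne ((huniq c hcF hc3 hcnb hv).trans (huniq c' hc'F hc'3 hc'nb hv').symm)
  have heq : (X.filter (fun v => ((facetNormals X).filter (fun c => v ∈ tightSet X c ∧ (tightSet X c).card = 3 ∧
        ((edgesOfFacet X c).filter (fun T => T ∉ B)).card = 0)).card = 3)) =
      ((facetNormals X).filter (fun c => (tightSet X c).card = 3 ∧
      ((edgesOfFacet X c).filter (fun T => T ∉ B)).card = 2)).biUnion (fun c => tightSet X c) := by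
    ext v
    rw [Finset.mem_filter, Finset.mem_biUnion]
    constructor
    · rintro ⟨hvX, htv⟩
      obtain ⟨c, hcF, hc3, hcnb, hvc, -⟩ := hC5 v hvX htv
      exact ⟨c, Finset.mem_filter.2 ⟨hcF, hc3, hcnb⟩, hvc⟩
    · rintro ⟨c, hc, hvc⟩
      obtain ⟨hcF, hc3, hcnb⟩ := Finset.mem_filter.1 hc
      exact ⟨(mem_tightSet.1 hvc).1, hC3 c hcF hc3 hcnb v hvc⟩
  refine ⟨heq, hdis, ?_⟩
  rw [heq, Finset.card_biUnion hdis]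
  rw [Finset.sum_congr rfl (fun c hc => (Finset.mem_filter.1 hc).2.1), Finset.sum_const, smul_eq_mul,
    Nat.mul_comm]

end Setting

end Summit.AtomisticToContinuum.Crystallization.Theorems.Cap
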